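import Summits.ValiantsHypothesis.ValiantsHypothesis.Theorems.BarrierLeverPartitionMinorsTwinBalancedSplitPrelims

/-!
# Route BarrierLever — Chow witnesses for partition minors (items 20172 / 20195): the TWIN-BALANCED
# SPLIT (a fourth block reduction: equally many `a`-twin rows and `c`-twin columns)

Helper file (`--supports stmt-ValiantsHypothesis-20172`; cell valiant-natproofs, rung V4, 𝒟-side of
door (c); seat valiant-natproofs-prover gen 13).  Closes NO item; definition-free.  Conventions of
items 19717 / 20172 / 20195: a layout `(u, w)` of height `h` is HIT when some product of `h + h`
affine forms has nonsingular partition minor `det[coeff_{E (u i) (w j)} ∏ ℓ]`, `x_a = X (castAdd h a)`,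
`y_c = X (natAdd h c)`.

**The twin-balanced split (`chow_twinBalancedSplit`).**  Let `(u, w)` be a layout of height `h + 1`
and `a`, `c` coordinates, in block form: the last `m` rows are `a`-TWIN BOTTOMS — row `natAdd n i`
avoids `a` and row `castAdd m (t i)` is exactly `insert a (u (natAdd n i))` — and, symmetrically, the
last `m` columns are `c`-twin bottoms with tops `castAdd m (t' j)`; the first `n` rows and columns are
otherwise ARBITRARY (they contain the twin tops, and may contain further rows with or without `a`).
So the ONLY numerical condition is `#(exhibited a-twin pairs) = #(exhibited c-twin pairs) = m`;
nothing relates literal classes (`chow_pairSplit`, `chow_pairSplit_mixed`), nothing relates twins to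
literal classes (`chow_twinSplit`), and twins ARE allowed (`chow_peel` is the case `m = 0`).  If the two
PROJECTED layouts of height `h` — «first `n` rows with `a` deleted × first `n` columns with `c` deleted»
and «the `m` twin-bottom rows × the `m` twin-bottom columns» (pulled back along `a.succAbove` /
`c.succAbove`) — are both hit, then `(u, w)` is hit.

Proof (a one-parameter deformation, new in the cell's engine): one product `∏ ℓ'` of `h + h` forms
hits both projected layouts (`exists_common_chow_witness₂`); lift it (`…CoordinateLift`) and multiply
by the two-form gadget `g_δ = (1 + x_a - δ y_c)(1 + (1 + δ) y_c)` whose multilinear table on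
`{1, x_a} × {1, y_c}` is `[[1, 1], [1, 1 + δ]]` (`coeff_balancedGadget`).  By
`coeff_partitionExpo_mul_pairFactor` the partition matrix is `F[u_i \ a, w_j \ c] · (1 + δ [a ∈ u_i][c ∈ w_j])`.
Subtracting from each twin-bottom row its top and from each twin-bottom column its top (unipotent
operations) turns the matrix into `fromBlocks (A + δ A₁) (δ B₁) (δ C₁) (δ D)`, hence
`det = δ^m · det (X₀ + δ X₁)` with `X₀ = fromBlocks A 0 C₁ D` block-TRIANGULAR, `det X₀ = det A · det D ≠ 0`
(`A`, `D` the two projected partition matrices).  A determinant that is nonzero at `δ = 0` is nonzero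
at some `δ ≠ 0` (`exists_ne_zero_and_det_add_smul_ne_zero`, via `Polynomial.roots`), which gives the
witness.  Census (seat folder lab/rulesets.py, exact rules, h = 4 sample of 6 000 layouts): the
tree's reductions {peel, pairSplit, pairSplit_mixed, twinSplit (both parities)} leave 40 irreducible,
adding the twin-balanced split leaves 37; at sizes r ∈ {6, 7} (3 000 layouts) 11 → 7.

**Corollary (`chow_hit_double`).**  Hit layouts are closed under CUBE DOUBLING: if `(U, W)` of height
`h` is hit then the layout of height `h + 1` with rows `insert a U↑ᵢ, U↑ᵢ` and columns `insert c W↑ⱼ, W↑ⱼ`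
(`2r` rows and columns) is hit — the case `n = m = r`, `t = t' = id` (both projected layouts are `(U, W)`).

WHAT THIS IS NOT: a reduction step (hits nothing by itself); nothing on items 20195 / 20172 / 19717
themselves, on crux stmt-ValiantsHypothesis-14610, or on `VP` versus `VNP`.
-/

set_option linter.dupNamespace false

namespace Summit.ValiantsHypothesis.ValiantsHypothesis.Theorems.BarrierLever.ChowFactor

open Finset MvPolynomial

noncomputable section

variable {h : ℕ}

/-! ## 1. The twin-balanced split -/

/-- **TWIN-BALANCED SPLIT for Chow witnesses (block form).**  The last `m` rows `natAdd n i` avoid `a`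
and `u (castAdd m (t i)) = insert a (u (natAdd n i))`; the last `m` columns `natAdd n j` avoid `c` and
`w (castAdd m (t' j)) = insert c (w (natAdd n j))`; the first `n` rows / columns are arbitrary.  If the
projected layouts «first `n` rows (minus `a`) × first `n` columns (minus `c`)» and «twin-bottom rows ×
twin-bottom columns» of height `h` are hit, so is `(u, w)` at height `h + 1`. -/
theorem chow_twinBalancedSplit (a c : Fin (h + 1)) {n m : ℕ}
    (u w : Fin (n + m) → Finset (Fin (h + 1))) (t t' : Fin m → Fin n)
    (hu0 : ∀ i : Fin m, a ∉ u (Fin.natAdd n i))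
    (hut : ∀ i : Fin m, u (Fin.castAdd m (t i)) = insert a (u (Fin.natAdd n i)))
    (hw0 : ∀ j : Fin m, c ∉ w (Fin.natAdd n j))
    (hwt : ∀ j : Fin m, w (Fin.castAdd m (t' j)) = insert c (w (Fin.natAdd n j)))
    (h0 : ∃ ℓ : Fin (h + h) → MvPolynomial (Fin (h + h)) ℂ, (∀ q, (ℓ q).totalDegree ≤ 1) ∧
      (Matrix.of fun i j : Fin n => coeff
        (∑ b ∈ (u (Fin.castAdd m i)).preimage a.succAbove Fin.succAbove_right_injective.injOn,
            Finsupp.single (Fin.castAdd h b) 1 +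
          ∑ d ∈ (w (Fin.castAdd m j)).preimage c.succAbove Fin.succAbove_right_injective.injOn,
            Finsupp.single (Fin.natAdd h d) 1)
        (∏ q, ℓ q)).det ≠ 0)
    (h1 : ∃ ℓ : Fin (h + h) → MvPolynomial (Fin (h + h)) ℂ, (∀ q, (ℓ q).totalDegree ≤ 1) ∧
      (Matrix.of fun i j : Fin m => coeff
        (∑ b ∈ (u (Fin.natAdd n i)).preimage a.succAbove Fin.succAbove_right_injective.injOn,
            Finsupp.single (Fin.castAdd h b) 1 +
          ∑ d ∈ (w (Fin.natAdd n j)).preimage c.succAbove Fin.succAbove_right_injective.injOn,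
            Finsupp.single (Fin.natAdd h d) 1)
        (∏ q, ℓ q)).det ≠ 0) :
    ∃ ℓ : Fin ((h + 1) + (h + 1)) → MvPolynomial (Fin ((h + 1) + (h + 1))) ℂ,
      (∀ q, (ℓ q).totalDegree ≤ 1) ∧
      (Matrix.of fun i j : Fin (n + m) => coeff
        (∑ a' ∈ u i, Finsupp.single (Fin.castAdd (h + 1) a') 1 +
          ∑ c' ∈ w j, Finsupp.single (Fin.natAdd (h + 1) c') 1)
        (∏ q, ℓ q)).det ≠ 0 := by
  classical
  obtain ⟨ℓ, hdeg, hA, hD⟩ := exists_common_chow_witness₂ _ _ _ _ h0 h1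
  -- the projected coefficient `F U W` of the witness at `(U \ a, W \ c)` (pulled back)
  set F : Finset (Fin (h + 1)) → Finset (Fin (h + 1)) → ℂ := fun U W => coeff
      (∑ b ∈ U.preimage a.succAbove Fin.succAbove_right_injective.injOn,
          Finsupp.single (Fin.castAdd h b) 1 +
        ∑ d ∈ W.preimage c.succAbove Fin.succAbove_right_injective.injOn,
          Finsupp.single (Fin.natAdd h d) 1) (∏ q, ℓ q) with hFdef
  -- the projected coefficient only sees `U \ a` and `W \ c`
  have hFeraseU : ∀ U W : Finset (Fin (h + 1)), F (U.erase a) W = F U W := by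
    intro U W
    rw [hFdef]
    dsimp only
    congr 3
    ext b
    simp only [Finset.mem_preimage, Finset.mem_erase, Fin.succAbove_ne, ne_eq, not_false_eq_true,
      true_and]
  have hFeraseW : ∀ U W : Finset (Fin (h + 1)), F U (W.erase c) = F U W := by
    intro U W
    rw [hFdef]
    dsimp only
    congr 3
    ext d
    simp only [Finset.mem_preimage, Finset.mem_erase, Fin.succAbove_ne, ne_eq, not_false_eq_true,
      true_and]
  have hFtop : ∀ (i : Fin m) (W : Finset (Fin (h + 1))),
      F (u (Fin.castAdd m (t i))) W = F (u (Fin.natAdd n i)) W := by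
    intro i W
    rw [hut i, ← hFeraseU (insert a _), Finset.erase_insert (hu0 i)]
  have hFtop' : ∀ (U : Finset (Fin (h + 1))) (j : Fin m),
      F U (w (Fin.castAdd m (t' j))) = F U (w (Fin.natAdd n j)) := by
    intro U j
    rw [hwt j, ← hFeraseW _ (insert c _), Finset.erase_insert (hw0 j)]
  -- the blocks of the limit matrix `X₀` and of the first-order term `X₁`
  set A : Matrix (Fin n) (Fin n) ℂ := Matrix.of fun i j : Fin n =>
    F (u (Fin.castAdd m i)) (w (Fin.castAdd m j)) with hAdef
  set D : Matrix (Fin m) (Fin m) ℂ := Matrix.of fun i j : Fin m =>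
    F (u (Fin.natAdd n i)) (w (Fin.natAdd n j)) with hDdef
  set A₁ : Matrix (Fin n) (Fin n) ℂ := Matrix.of fun i j : Fin n =>
    (if a ∈ u (Fin.castAdd m i) ∧ c ∈ w (Fin.castAdd m j) then (1 : ℂ) else 0) *
      F (u (Fin.castAdd m i)) (w (Fin.castAdd m j)) with hA₁def
  set B₁ : Matrix (Fin n) (Fin m) ℂ := Matrix.of fun (i : Fin n) (j : Fin m) =>
    -((if a ∈ u (Fin.castAdd m i) then (1 : ℂ) else 0) * F (u (Fin.castAdd m i)) (w (Fin.natAdd n j)))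
    with hB₁def
  set C₁ : Matrix (Fin m) (Fin n) ℂ := Matrix.of fun (i : Fin m) (j : Fin n) =>
    -((if c ∈ w (Fin.castAdd m j) then (1 : ℂ) else 0) * F (u (Fin.natAdd n i)) (w (Fin.castAdd m j)))
    with hC₁def
  set X₀ : Matrix (Fin n ⊕ Fin m) (Fin n ⊕ Fin m) ℂ := Matrix.fromBlocks A 0 C₁ D with hX₀def
  set X₁ : Matrix (Fin n ⊕ Fin m) (Fin n ⊕ Fin m) ℂ := Matrix.fromBlocks A₁ B₁ 0 0 with hX₁def
  have hX₀ : X₀.det ≠ 0 := by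
    rw [hX₀def, Matrix.det_fromBlocks_zero₁₂]
    exact mul_ne_zero hA hD
  obtain ⟨δ, hδ0, hδ⟩ := exists_ne_zero_and_det_add_smul_ne_zero X₀ X₁ hX₀
  -- the lift and the gadget
  set L : Fin (h + h) → Fin ((h + 1) + (h + 1)) := Fin.append
    (fun b : Fin h => Fin.castAdd (h + 1) (a.succAbove b))
    (fun d : Fin h => Fin.natAdd (h + 1) (c.succAbove d)) with hL
  set f₁ : MvPolynomial (Fin ((h + 1) + (h + 1))) ℂ :=
    C 1 + C 1 * X (Fin.castAdd (h + 1) a) + C (-δ) * X (Fin.natAdd (h + 1) c) with hf₁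
  set f₂ : MvPolynomial (Fin ((h + 1) + (h + 1))) ℂ :=
    C 1 + C 0 * X (Fin.castAdd (h + 1) a) + C (1 + δ) * X (Fin.natAdd (h + 1) c) with hf₂
  have hcard : (h + h) + 2 = (h + 1) + (h + 1) := by omega
  set e : Fin ((h + h) + 2) ≃ Fin ((h + 1) + (h + 1)) := finCongr hcard with he
  set ℓ' : Fin ((h + h) + 2) → MvPolynomial (Fin ((h + 1) + (h + 1))) ℂ :=
    Fin.append (fun q => rename L (ℓ q)) ![f₁, f₂] with hℓ'
  refine ⟨fun q => ℓ' (e.symm q), fun q => ?_, ?_⟩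
  · show (ℓ' (e.symm q)).totalDegree ≤ 1
    generalize e.symm q = q₀
    rw [hℓ']
    induction q₀ using Fin.addCases with
    | left q' =>
      rw [Fin.append_left]
      exact totalDegree_rename_le_one L (ℓ q') (hdeg q')
    | right q' =>
      rw [Fin.append_right]
      fin_cases q'
      · exact totalDegree_affine_xy_le a c 1 (-δ)
      · exact totalDegree_affine_xy_le a c 0 (1 + δ)
  · -- the product
    have hprod : (∏ q, ℓ' (e.symm q)) = (f₁ * f₂) * rename L (∏ q, ℓ q) := by
      rw [Fintype.prod_equiv e.symm (fun q => ℓ' (e.symm q)) ℓ' (fun _ => rfl), hℓ',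
        Fin.prod_univ_add]
      simp only [Fin.append_left, Fin.append_right, Fin.prod_univ_two, Matrix.cons_val_zero,
        Matrix.cons_val_one]
      rw [map_prod, mul_comm]
    rw [hprod]
    -- entries of the partition matrix
    have hane : ({a} : Finset (Fin (h + 1))) ≠ ∅ := Finset.singleton_ne_empty a
    have hcne : ({c} : Finset (Fin (h + 1))) ≠ ∅ := Finset.singleton_ne_empty c
    have hentry : ∀ i j : Fin (n + m), coeff
        (∑ a' ∈ u i, Finsupp.single (Fin.castAdd (h + 1) a') 1 +
          ∑ c' ∈ w j, Finsupp.single (Fin.natAdd (h + 1) c') 1) ((f₁ * f₂) * rename L (∏ q, ℓ q)) =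
        (if a ∈ u i ∧ c ∈ w j then 1 + δ else 1) * F (u i) (w j) := by
      intro i j
      rw [coeff_partitionExpo_mul_pairFactor _ _ a c (support_balancedGadget a c δ)
        (support_rename_lift a c _) (u i) (w j)]
      have hfa : (u i).filter (fun a' => a' = a) = u i ∩ {a} := by
        ext x; simp [Finset.mem_filter, Finset.mem_inter]
      have hfc : (w j).filter (fun c' => c' = c) = w j ∩ {c} := by
        ext x; simp [Finset.mem_filter, Finset.mem_inter]
      rw [hfa, hfc, coeff_balancedGadget a c δ _ _ ?_ ?_, erase_eq_map_preimage_succAbove,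
        erase_eq_map_preimage_succAbove, coeff_lift_rename]
      · have hcond : (u i ∩ {a} = {a} ∧ w j ∩ {c} = {c}) ↔ (a ∈ u i ∧ c ∈ w j) := by
          constructor
          · rintro ⟨h1, h2⟩
            exact ⟨Finset.mem_of_mem_inter_left (h1.symm ▸ Finset.mem_singleton_self a),
              Finset.mem_of_mem_inter_left (h2.symm ▸ Finset.mem_singleton_self c)⟩
          · rintro ⟨h1, h2⟩
            exact ⟨Finset.inter_singleton_of_mem h1, Finset.inter_singleton_of_mem h2⟩
        rw [if_congr hcond rfl rfl]
      · by_cases ha : a ∈ u i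
        · right; rw [Finset.inter_singleton_of_mem ha]
        · left; rw [Finset.inter_singleton_of_notMem ha]
      · by_cases hc : c ∈ w j
        · right; rw [Finset.inter_singleton_of_mem hc]
        · left; rw [Finset.inter_singleton_of_notMem hc]
    -- block form
    set A' : Matrix (Fin n) (Fin n) ℂ := Matrix.of fun i j : Fin n =>
      (if a ∈ u (Fin.castAdd m i) ∧ c ∈ w (Fin.castAdd m j) then 1 + δ else 1) *
        F (u (Fin.castAdd m i)) (w (Fin.castAdd m j)) with hA'def
    set B' : Matrix (Fin n) (Fin m) ℂ := Matrix.of fun (i : Fin n) (j : Fin m) =>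
      F (u (Fin.castAdd m i)) (w (Fin.natAdd n j)) with hB'def
    set Cm : Matrix (Fin m) (Fin n) ℂ := Matrix.of fun (i : Fin m) (j : Fin n) =>
      F (u (Fin.natAdd n i)) (w (Fin.castAdd m j)) with hCmdef
    have hN : (Matrix.of fun i j : Fin (n + m) => coeff
        (∑ a' ∈ u i, Finsupp.single (Fin.castAdd (h + 1) a') 1 +
          ∑ c' ∈ w j, Finsupp.single (Fin.natAdd (h + 1) c') 1) ((f₁ * f₂) * rename L (∏ q, ℓ q))) =
        Matrix.reindex finSumFinEquiv finSumFinEquiv (Matrix.fromBlocks A' B' Cm D) := by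
      ext i j
      rw [Matrix.of_apply, hentry, Matrix.reindex_apply, Matrix.submatrix_apply]
      induction i using Fin.addCases with
      | left i₀ =>
        induction j using Fin.addCases with
        | left j₀ =>
          rw [finSumFinEquiv_symm_apply_castAdd, finSumFinEquiv_symm_apply_castAdd,
            Matrix.fromBlocks_apply₁₁, hA'def, Matrix.of_apply]
        | right j₁ =>
          rw [finSumFinEquiv_symm_apply_castAdd, finSumFinEquiv_symm_apply_natAdd,
            Matrix.fromBlocks_apply₁₂, hB'def, Matrix.of_apply]
          simp [hw0 j₁]
      | right i₁ =>
        induction j using Fin.addCases with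
        | left j₀ =>
          rw [finSumFinEquiv_symm_apply_natAdd, finSumFinEquiv_symm_apply_castAdd,
            Matrix.fromBlocks_apply₂₁, hCmdef, Matrix.of_apply]
          simp [hu0 i₁]
        | right j₁ =>
          rw [finSumFinEquiv_symm_apply_natAdd, finSumFinEquiv_symm_apply_natAdd,
            Matrix.fromBlocks_apply₂₂, hDdef, Matrix.of_apply]
          simp [hu0 i₁]
    -- the twin incidence matrices and the unipotent row / column operations
    set N : Matrix (Fin m) (Fin n) ℂ := Matrix.of fun i' i => if i = t i' then (1 : ℂ) else 0
      with hNdef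
    set Nc : Matrix (Fin n) (Fin m) ℂ := Matrix.of fun j j' => if j = t' j' then (1 : ℂ) else 0
      with hNcdef
    have hA'eq : A' = A + δ • A₁ := by
      ext i j
      rw [hA'def, Matrix.add_apply, Matrix.smul_apply, hAdef, hA₁def, Matrix.of_apply, Matrix.of_apply,
        Matrix.of_apply, smul_eq_mul]
      split_ifs <;> ring
    have hNA : N * A' = Cm - δ • C₁ := by
      ext i' j
      rw [Matrix.mul_apply, Finset.sum_eq_single (t i'), Matrix.sub_apply, Matrix.smul_apply,
        smul_eq_mul]
      · rw [hNdef, hA'def, hCmdef, hC₁def, Matrix.of_apply, Matrix.of_apply, Matrix.of_apply,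
          Matrix.of_apply, if_pos rfl, one_mul, hFtop i', hut i']
        simp only [Finset.mem_insert_self, true_and]
        split_ifs <;> ring
      · intro i _ hi
        rw [hNdef, Matrix.of_apply, if_neg hi, zero_mul]
      · intro ht
        exact absurd (Finset.mem_univ _) ht
    have hNB : N * B' = D := by
      ext i' j'
      rw [Matrix.mul_apply, Finset.sum_eq_single (t i')]
      · rw [hNdef, hB'def, hDdef, Matrix.of_apply, Matrix.of_apply, Matrix.of_apply, if_pos rfl,
          one_mul, hFtop i']
      · intro i _ hi
        rw [hNdef, Matrix.of_apply, if_neg hi, zero_mul]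
      · intro ht
        exact absurd (Finset.mem_univ _) ht
    have hANc : A' * Nc = B' - δ • B₁ := by
      ext i j'
      rw [Matrix.mul_apply, Finset.sum_eq_single (t' j'), Matrix.sub_apply, Matrix.smul_apply,
        smul_eq_mul]
      · rw [hNcdef, hA'def, hB'def, hB₁def, Matrix.of_apply, Matrix.of_apply, Matrix.of_apply,
          Matrix.of_apply, if_pos rfl, mul_one, hFtop' _ j', hwt j']
        simp only [Finset.mem_insert_self, and_true]
        split_ifs <;> ring
      · intro j _ hj
        rw [hNcdef, Matrix.of_apply, if_neg hj, mul_zero]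
      · intro ht
        exact absurd (Finset.mem_univ _) ht
    have hCNc : C₁ * Nc = -D := by
      ext i' j'
      rw [Matrix.mul_apply, Finset.sum_eq_single (t' j'), Matrix.neg_apply]
      · rw [hNcdef, hC₁def, hDdef, Matrix.of_apply, Matrix.of_apply, Matrix.of_apply, if_pos rfl,
          mul_one, hFtop' _ j', hwt j']
        simp only [Finset.mem_insert_self, if_true, one_mul]
      · intro j _ hj
        rw [hNcdef, Matrix.of_apply, if_neg hj, mul_zero]
      · intro ht
        exact absurd (Finset.mem_univ _) ht
    have hE₁ : Matrix.fromBlocks (1 : Matrix (Fin n) (Fin n) ℂ) 0 (-N) (1 : Matrix (Fin m) (Fin m) ℂ) *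
        Matrix.fromBlocks A' B' Cm D = Matrix.fromBlocks A' B' (δ • C₁) 0 := by
      rw [Matrix.fromBlocks_multiply, Matrix.neg_mul, Matrix.neg_mul, hNA, hNB]
      simp only [Matrix.one_mul, Matrix.zero_mul, add_zero, neg_sub, sub_add_cancel, neg_add_cancel]
    have hE₂ : Matrix.fromBlocks A' B' (δ • C₁) (0 : Matrix (Fin m) (Fin m) ℂ) *
        Matrix.fromBlocks (1 : Matrix (Fin n) (Fin n) ℂ) (-Nc) 0 (1 : Matrix (Fin m) (Fin m) ℂ) =
        Matrix.fromBlocks A' (δ • B₁) (δ • C₁) (δ • D) := by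
      rw [Matrix.fromBlocks_multiply]
      simp only [Matrix.mul_one, Matrix.mul_zero, add_zero, Matrix.mul_neg,
        Matrix.smul_mul, hANc, hCNc, smul_neg, neg_neg, neg_sub, sub_add_cancel]
    have hdetL : (Matrix.fromBlocks (1 : Matrix (Fin n) (Fin n) ℂ) 0 (-N)
        (1 : Matrix (Fin m) (Fin m) ℂ)).det = 1 := by
      rw [Matrix.det_fromBlocks_zero₁₂, Matrix.det_one, Matrix.det_one, mul_one]
    have hdetR : (Matrix.fromBlocks (1 : Matrix (Fin n) (Fin n) ℂ) (-Nc) 0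
        (1 : Matrix (Fin m) (Fin m) ℂ)).det = 1 := by
      rw [Matrix.det_fromBlocks_zero₂₁, Matrix.det_one, Matrix.det_one, mul_one]
    -- factor `δ` out of the last `m` rows: what is left is `X₀ + δ • X₁`
    have hfac : Matrix.fromBlocks A' (δ • B₁) (δ • C₁) (δ • D) =
        Matrix.fromBlocks (1 : Matrix (Fin n) (Fin n) ℂ) 0 0 (δ • (1 : Matrix (Fin m) (Fin m) ℂ)) *
          (X₀ + δ • X₁) := by
      rw [hX₀def, hX₁def, Matrix.fromBlocks_smul, Matrix.fromBlocks_add, Matrix.fromBlocks_multiply,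
        hA'eq]
      simp only [Matrix.one_mul, Matrix.zero_mul, add_zero, zero_add, smul_zero, Matrix.smul_mul]
    have hdetS : (Matrix.fromBlocks (1 : Matrix (Fin n) (Fin n) ℂ) 0 0
        (δ • (1 : Matrix (Fin m) (Fin m) ℂ))).det = δ ^ m := by
      rw [Matrix.det_fromBlocks_zero₁₂, Matrix.det_one, one_mul, Matrix.det_smul, Matrix.det_one,
        mul_one, Fintype.card_fin]
    have hdet : (Matrix.fromBlocks A' B' Cm D).det = δ ^ m * (X₀ + δ • X₁).det := by
      have e1 := congrArg Matrix.det hE₁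
      rw [Matrix.det_mul, hdetL, one_mul] at e1
      have e2 := congrArg Matrix.det hE₂
      rw [Matrix.det_mul, hdetR, mul_one, hfac, Matrix.det_mul, hdetS] at e2
      rw [e1, e2]
    rw [hN, Matrix.det_reindex_self, hdet]
    exact mul_ne_zero (pow_ne_zero _ hδ0) hδ

/-! ## 2. Corollary: cube doubling -/

/-- **CUBE DOUBLING.**  If the layout `(U, W)` of height `h` is hit by a product of `h + h` affine
forms, then the layout of height `h + 1` whose rows are `insert a U↑ᵢ` (`i < r`) and `U↑ᵢ` (the lifts
along `a.succAbove`) and whose columns are `insert c W↑ⱼ`, `W↑ⱼ` is hit by a product of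
`(h + 1) + (h + 1)` affine forms: the twin-balanced split with `n = m = r` and `t = t' = id`, both
projected layouts being `(U, W)` itself. -/
theorem chow_hit_double (a c : Fin (h + 1)) {r : ℕ} (U W : Fin r → Finset (Fin h))
    (hUW : ∃ ℓ : Fin (h + h) → MvPolynomial (Fin (h + h)) ℂ, (∀ q, (ℓ q).totalDegree ≤ 1) ∧
      (Matrix.of fun i j : Fin r => coeff
        (∑ b ∈ U i, Finsupp.single (Fin.castAdd h b) 1 + ∑ d ∈ W j, Finsupp.single (Fin.natAdd h d) 1)
        (∏ q, ℓ q)).det ≠ 0) :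
    ∃ ℓ : Fin ((h + 1) + (h + 1)) → MvPolynomial (Fin ((h + 1) + (h + 1))) ℂ,
      (∀ q, (ℓ q).totalDegree ≤ 1) ∧
      (Matrix.of fun i j : Fin (r + r) => coeff
        (∑ a' ∈ Fin.append (fun i => insert a ((U i).map (Fin.succAboveEmb a)))
            (fun i => (U i).map (Fin.succAboveEmb a)) i, Finsupp.single (Fin.castAdd (h + 1) a') 1 +
          ∑ c' ∈ Fin.append (fun j => insert c ((W j).map (Fin.succAboveEmb c)))
            (fun j => (W j).map (Fin.succAboveEmb c)) j, Finsupp.single (Fin.natAdd (h + 1) c') 1)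
        (∏ q, ℓ q)).det ≠ 0 := by
  classical
  refine chow_twinBalancedSplit a c _ _ id id (fun i => ?_) (fun i => ?_) (fun j => ?_) (fun j => ?_)
    ?_ ?_
  · rw [Fin.append_right]
    exact not_mem_map_succAboveEmb a (U i)
  · rw [Fin.append_left, Fin.append_right, id]
  · rw [Fin.append_right]
    exact not_mem_map_succAboveEmb c (W j)
  · rw [Fin.append_left, Fin.append_right, id]
  · obtain ⟨ℓ, hd, hdet⟩ := hUW
    refine ⟨ℓ, hd, ?_⟩
    simp only [Fin.append_left, preimage_succAbove_insert_map]
    exact hdet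
  · obtain ⟨ℓ, hd, hdet⟩ := hUW
    refine ⟨ℓ, hd, ?_⟩
    simp only [Fin.append_right, preimage_succAbove_map]
    exact hdet

end

end Summit.ValiantsHypothesis.ValiantsHypothesis.Theorems.BarrierLever.ChowFactor
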